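import Mathlib
import HarnessLib
import Literature.MathematicalPhysics.QuantumLattice.FermiRG.BGM2003Sectors
import Summits.HubbardSuperconductivity.HubbardSuperconductivity.Theorems.KLProgrammeAbsUmklappClassCountPrescribed
import Summits.HubbardSuperconductivity.HubbardSuperconductivity.Theorems.KLProgrammeAbsUmklappClassFibreMixed

/-!
# Route `KLProgramme` — K3 engine (stmt-HubbardSuperconductivity-20437), stub (b) (ℓ)/(I2)–(I3), located item «ABS-UMK-COUNT» / «ABS-UMK-34-SIGNPAT»:
# the COUNT OF ONE NARROW CLASS with a prescribed NONEMPTY set of legs and ≥ 3 free legs — `≤ T · K₁^{L − |E| − 3}`, both sign patterns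

Cell gate-hubbard-kl, seat p4 g16 (≥ 3-free-leg twin of `card_narrowClass_prescribed_le`, p623169).  The chart is anchored at a PRESCRIBED leg `s ∈ E` shifted by
an arbitrary `σ` (the coverage lemma runs `σ` over a grid of `O(1/Φ₀)` shifts and `{0, π}`), so no fourth free leg is needed; the kept triple `a, b, c ∉ E`
has either all three legs within `2Φ₀` of `θ⋆ = θ_{n′,τ_s} + σ` (DEFINITE pattern, fibres by `card_classFibre_le_pred`) or `a, b` there and `c` within `2Φ₀` of
`θ⋆ + π` (MIXED pattern, fibres by `card_classFibre_le_mixed`); every other free leg lies within pair angle `2Φ₀` of `θ⋆` and is sliced (cone of size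
`K₁ = 2(4Φ₀/w + 1)`):

* `card_le_mul_pow_of_fibres` — the projection/product bookkeeping: a class whose members agree with `τ` on `E` and whose free legs lie within pair angle
  `2Φ₀` of a fixed `θ⋆`, with fibres (kept legs zeroed) of size `≤ T`, has `≤ T · K₁^{L − (|E| + 3)}` members;
* **`card_class34_same_le`** (`≤ T_def · K₁^{L − (|E|+3)}`), **`card_class34_opp_le`** (`≤ T_indef · K₁^{L − (|E|+3)}`).

Everything is PROVED; no definitions, no named facts. [cite: BenfattoGiulianiMastropietro2003, §7.4 (s1.23)–(s1.25a) p.28 (L33–52)]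
-/

noncomputable section

open Real Set
open Literature.MathematicalPhysics.QuantumLattice Literature.MathematicalPhysics.QuantumLattice.FermiRG
open Literature.MathematicalPhysics.QuantumLattice.FermiRG.BGM2003
open Summit.HubbardSuperconductivity.HubbardSuperconductivity.Theorems.ThinLevelSet
open Summit.HubbardSuperconductivity.HubbardSuperconductivity.Theorems

namespace Summit.HubbardSuperconductivity.HubbardSuperconductivity.Theorems.AbsUmklappCount

set_option linter.dupNamespace false -- summit = problem name (single-conjunct summit), D-0017

/-! ## §1 Projection and product bookkeeping -/

open Classical in
/-- **Slicing the free legs other than the kept triple.**  Let `Cl` be a set of strings agreeing with `τ` on `E` whose legs off `E` lie within pair angle `2Φ₀` of a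
fixed direction `θ⋆`, and let `a, b, c ∉ E` be distinct.  If every fibre of the projection zeroing `a, b, c` has at most `T` elements of `Cl`, then
`#Cl ≤ T · (2(4Φ₀/w + 1))^{L − (|E| + 3)}`. [cite: BenfattoGiulianiMastropietro2003, §7.4 (s1.23)–(s1.25a) p.28 (L33–52)] -/
theorem card_le_mul_pow_of_fibres {n' L : ℕ} (E : Finset (Fin L)) (τ : Fin L → Fin (sectorCount n')) (a b c : Fin L)
    (haE : a ∉ E) (hbE : b ∉ E) (hcE : c ∉ E) (hab : a ≠ b) (hac : a ≠ c) (hbc : b ≠ c) (θc : ℝ) {Φ₀ T : ℝ} (hΦ₀ : 0 ≤ Φ₀) (hT : 0 ≤ T)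
    (Cl : Finset (Fin L → Fin (sectorCount n')))
    (hCl : ∀ ω ∈ Cl, (∀ e ∈ E, ω e = τ e) ∧ ∀ i, i ∉ E → pairAngle (sectorCenter n' (ω i)) θc ≤ 2 * Φ₀)
    (hfib : ∀ ρ : Fin L → Fin (sectorCount n'),
      (((Cl.filter fun ω => Function.update (Function.update (Function.update ω a ⟨0, sectorCount_pos n'⟩) b ⟨0, sectorCount_pos n'⟩) c
        ⟨0, sectorCount_pos n'⟩ = ρ).card : ℕ) : ℝ) ≤ T) :
    (Cl.card : ℝ) ≤ T * (2 * (2 * (2 * Φ₀) / sectorWidth n' + 1)) ^ (L - (E.card + 3)) := by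
  set z : Fin (sectorCount n') := ⟨0, sectorCount_pos n'⟩ with hz
  set upd : (Fin L → Fin (sectorCount n')) → (Fin L → Fin (sectorCount n')) :=
    fun ω => Function.update (Function.update (Function.update ω a z) b z) c z with hupd
  have hw := sectorWidth_pos n'
  set K₁ : ℝ := 2 * (2 * (2 * Φ₀) / sectorWidth n' + 1) with hK₁
  have hK₁0 : 0 ≤ K₁ := by rw [hK₁]; positivity
  -- values of the projection
  have hupd_a : ∀ ω, upd ω a = z := fun ω => by
    rw [hupd]; simp only; rw [Function.update_of_ne hac, Function.update_of_ne hab, Function.update_self]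
  have hupd_b : ∀ ω, upd ω b = z := fun ω => by
    rw [hupd]; simp only; rw [Function.update_of_ne hbc, Function.update_self]
  have hupd_c : ∀ ω, upd ω c = z := fun ω => by
    rw [hupd]; simp only; rw [Function.update_self]
  have hupd_of_ne : ∀ ω i, i ≠ a → i ≠ b → i ≠ c → upd ω i = ω i := fun ω i hia' hib' hic' => by
    rw [hupd]; simp only; rw [Function.update_of_ne hic', Function.update_of_ne hib', Function.update_of_ne hia']
  -- the coordinate sets
  set cone : Finset (Fin (sectorCount n')) :=
    (Finset.univ : Finset (Fin (sectorCount n'))).filter fun x : Fin (sectorCount n') => pairAngle (sectorCenter n' x) θc ≤ 2 * Φ₀ with hcone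
  set B : Fin L → Finset (Fin (sectorCount n')) := fun i =>
    if i = a ∨ i = b ∨ i = c then {z} else if i ∈ E then {τ i} else cone with hB
  set P : Finset (Fin L → Fin (sectorCount n')) := Fintype.piFinset B with hP
  -- the class projects into `P`
  have Hf : ∀ ω ∈ Cl, upd ω ∈ P := by
    intro ω hω
    obtain ⟨hωE, hnar⟩ := hCl ω hω
    rw [hP, Fintype.mem_piFinset]
    intro i
    rw [hB]; simp only
    by_cases hiabc : i = a ∨ i = b ∨ i = c
    · rw [if_pos hiabc, Finset.mem_singleton]
      rcases hiabc with h | h | h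
      · rw [h]; exact hupd_a ω
      · rw [h]; exact hupd_b ω
      · rw [h]; exact hupd_c ω
    rw [if_neg hiabc]
    have hiabc' : i ≠ a ∧ i ≠ b ∧ i ≠ c := by
      refine ⟨fun h => hiabc (Or.inl h), fun h => hiabc (Or.inr (Or.inl h)), fun h => hiabc (Or.inr (Or.inr h))⟩
    rw [hupd_of_ne ω i hiabc'.1 hiabc'.2.1 hiabc'.2.2]
    by_cases hiE : i ∈ E
    · rw [if_pos hiE, Finset.mem_singleton]; exact hωE i hiE
    rw [if_neg hiE, hcone, Finset.mem_filter]
    exact ⟨Finset.mem_univ _, hnar i hiE⟩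
  -- every fibre has at most `⌊T⌋₊` elements
  have hn : ∀ ρ ∈ P, (Cl.filter fun ω => upd ω = ρ).card ≤ ⌊T⌋₊ := by
    intro ρ _
    apply Nat.le_floor
    have h := hfib ρ
    rw [hupd]
    exact h
  have h1 : Cl.card ≤ ⌊T⌋₊ * P.card := Finset.card_le_mul_card_image_of_maps_to Hf ⌊T⌋₊ hn
  -- the distinguished legs: `a, b, c` and the prescribed set `E`
  set A : Finset (Fin L) := insert a (insert b (insert c E)) with hA
  have hAcard : A.card = E.card + 3 := by
    rw [hA, Finset.card_insert_of_notMem (by simp [hab, hac, haE]), Finset.card_insert_of_notMem (by simp [hbc, hbE]),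
      Finset.card_insert_of_notMem hcE]
  have hAc : Aᶜ.card = L - (E.card + 3) := by rw [Finset.card_compl, hAcard, Fintype.card_fin]
  have hmemAc : ∀ i ∈ Aᶜ, i ∉ E ∧ i ≠ a ∧ i ≠ b ∧ i ≠ c := by
    intro i hi
    rw [Finset.mem_compl, hA] at hi
    simp only [Finset.mem_insert, not_or] at hi
    exact ⟨hi.2.2.2, hi.1, hi.2.1, hi.2.2.1⟩
  -- the product of the coordinate-set sizes
  have hPcard : (P.card : ℝ) ≤ K₁ ^ (L - (E.card + 3)) := by
    rw [hP, Fintype.card_piFinset, ← Finset.prod_mul_prod_compl A]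
    have hA1 : ∏ i ∈ A, (B i).card ≤ 1 := by
      have hle : ∀ i ∈ A, (B i).card ≤ 1 := by
        intro i hi
        rw [hB]; simp only
        by_cases h1 : i = a ∨ i = b ∨ i = c
        · rw [if_pos h1, Finset.card_singleton]
        rw [if_neg h1]
        by_cases h3 : i ∈ E
        · rw [if_pos h3, Finset.card_singleton]
        · exfalso
          rw [hA] at hi
          simp only [Finset.mem_insert] at hi
          rcases hi with h | h | h | h
          · exact h1 (Or.inl h)
          · exact h1 (Or.inr (Or.inl h))
          · exact h1 (Or.inr (Or.inr h))
          · exact h3 h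
      have h := Finset.prod_le_pow_card A (fun i => (B i).card) 1 hle
      rwa [one_pow] at h
    have hA2 : ∏ i ∈ Aᶜ, (B i).card = cone.card ^ (L - (E.card + 3)) := by
      rw [← hAc, ← Finset.prod_const]
      refine Finset.prod_congr rfl fun i hi => ?_
      obtain ⟨h1, h3, h4, h5⟩ := hmemAc i hi
      rw [hB]; simp only
      rw [if_neg (by rw [not_or, not_or]; exact ⟨h3, h4, h5⟩), if_neg h1]
    have hcone_le : (cone.card : ℝ) ≤ K₁ := by
      rw [hcone, hK₁]; exact card_cone_pairAngle_le n' θc (2 * Φ₀) (by positivity)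
    have hcast : (((∏ i ∈ A, (B i).card) * ∏ i ∈ Aᶜ, (B i).card : ℕ) : ℝ) ≤ 1 * K₁ ^ (L - (E.card + 3)) := by
      rw [hA2]; push_cast
      exact mul_le_mul (by exact_mod_cast hA1) (pow_le_pow_left₀ (Nat.cast_nonneg _) hcone_le _) (by positivity) zero_le_one
    rw [one_mul] at hcast
    exact hcast
  -- assemble
  have h2 : (Cl.card : ℝ) ≤ (⌊T⌋₊ : ℝ) * (P.card : ℝ) := by exact_mod_cast h1
  have h3 : (⌊T⌋₊ : ℝ) ≤ T := Nat.floor_le hT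
  calc (Cl.card : ℝ) ≤ (⌊T⌋₊ : ℝ) * (P.card : ℝ) := h2
    _ ≤ T * K₁ ^ (L - (E.card + 3)) := mul_le_mul h3 hPcard (Nat.cast_nonneg _) hT

/-! ## §2 The two classes -/

open Classical in
set_option maxHeartbeats 400000 in -- large explicit statements
/-- **The count of one narrow class, DEFINITE pattern** (kept legs `a, b, c ∉ E` within `2Φ₀` of `θ⋆ = θ_{n′,ω_s} + σ`, `s ∈ E`; free legs within pair angle
`2Φ₀` of `θ_{n′,τ_s} + σ`): `#class ≤ T_def · K₁^{L − (|E|+3)}`. [cite: BenfattoGiulianiMastropietro2003, §7.4 (s1.23)–(s1.25a) p.28 (L33–52)] -/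
theorem card_class34_same_le {ε : (Fin 2 → ℝ) → ℝ} {μ e₀ : ℝ} {u : ℝ → ℝ → ℝ} (hD : DispersionHyp ε μ e₀ u) {c₃ : ℝ} (hc₃ : 0 < c₃)
    (h73 : ∀ (n ω : ℕ), ω < sectorCount n → ∀ p ∈ sSector u e₀ n ω,
      ∃ k₁ k₂ : ℝ,
        p = fermiPoint u (sectorCenter n ω) + k₁ • unitNormal u (sectorCenter n ω) 0 +
              k₂ • unitTangent u (sectorCenter n ω) 0 ∧
        |k₁| ≤ c₃ * (4 : ℝ) ^ (-(n : ℤ)) ∧ |k₂| ≤ c₃ * (2 : ℝ) ^ (-(n : ℤ)) ∧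
        |fderiv ℝ ε p (unitTangent u (sectorCenter n ω) 0)| ≤ c₃ * (2 : ℝ) ^ (-(n : ℤ)))
    {s₁ Φ cf Af Bf M₁ : ℝ} (hs₁ : 0 < s₁) (hM₁ : 0 ≤ M₁) (hΦ : 0 < Φ) (hcf : 0 < cf) (hcfA : cf ≤ Af) (hBf : 0 ≤ Bf)
    (hchart : ∀ θs : ℝ, ∃ f f' f'' : ℝ → ℝ, Measurable f ∧
        (∀ φ ∈ Icc (-Φ) Φ,
          f ((fermiPoint u (θs + φ) - fermiPoint u θs) ⬝ᵥ tdir θs) = -((fermiPoint u (θs + φ) - fermiPoint u θs) ⬝ᵥ dir θs)) ∧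
        (∀ y ∈ Icc (-(s₁ / 4 * Φ)) (s₁ / 4 * Φ), HasDerivAt f (f' y) y ∧ HasDerivAt f' (f'' y) y ∧
          cf ≤ f'' y ∧ f'' y ≤ Af ∧ |f' y| ≤ Bf) ∧
        (∀ φ ∈ Icc (-Φ) Φ, ∀ φ' ∈ Icc (-Φ) Φ,
          s₁ / 2 * |φ - φ'| ≤ |(fermiPoint u (θs + φ) - fermiPoint u θs) ⬝ᵥ tdir θs - (fermiPoint u (θs + φ') - fermiPoint u θs) ⬝ᵥ tdir θs| ∧
          |(fermiPoint u (θs + φ) - fermiPoint u θs) ⬝ᵥ tdir θs - (fermiPoint u (θs + φ') - fermiPoint u θs) ⬝ᵥ tdir θs| ≤ M₁ * |φ - φ'|) ∧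
        (fermiPoint u (θs + 0) - fermiPoint u θs) ⬝ᵥ tdir θs = 0)
    {n' L : ℕ} (E : Finset (Fin L)) (τ : Fin L → Fin (sectorCount n')) (s a b c : Fin L)
    (hsE : s ∈ E) (haE : a ∉ E) (hbE : b ∉ E) (hcE : c ∉ E) (hab : a ≠ b) (hac : a ≠ c) (hbc : b ≠ c)
    (R : Fin 2 → ℝ) {Φ₀ : ℝ} (hΦ₀ : 0 ≤ Φ₀) (h2Φ₀ : 2 * Φ₀ ≤ Φ) (σ : ℝ)
    (hreg : 6 * (M₁ * (2 * Φ₀)) + 3 * (L * (4 * c₃ * (2 : ℝ) ^ (-(n' : ℤ)))) + 2 * (s₁ / 2 * sectorWidth n') ≤ s₁ / 4 * Φ) :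
    ((((Finset.univ : Finset (Fin L → Fin (sectorCount n'))).filter fun ω =>
        ((∀ e ∈ E, ω e = τ e) ∧ (∀ i : Fin L, i ∉ E → pairAngle (sectorCenter n' (ω i)) (sectorCenter n' (τ s) + σ) ≤ 2 * Φ₀)) ∧
        (∀ x ∈ ({a, b, c} : Finset (Fin L)), FermiRG.torusDist (sectorCenter n' (ω x) - (sectorCenter n' (ω s) + σ)) ≤ 2 * Φ₀) ∧
        ∃ k : Fin L → (Fin 2 → ℝ), (∀ i, k i ∈ sSector u e₀ n' (ω i : ℕ)) ∧ ∑ i, k i = R).card : ℝ)) ≤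
      (2 * (L * (4 * c₃ * (2 : ℝ) ^ (-(n' : ℤ)))) / (s₁ / 2 * sectorWidth n') + 1) *
        (960 * Af * (2 * (L * (4 * c₃ * (2 : ℝ) ^ (-(n' : ℤ))) + Bf * (L * (4 * c₃ * (2 : ℝ) ^ (-(n' : ℤ))))) +
          (4 * Bf + 1) * (s₁ / 2 * sectorWidth n')) / cf ^ 2 / (s₁ / 2 * sectorWidth n') ^ 2) *
      (2 * (2 * (2 * Φ₀) / sectorWidth n' + 1)) ^ (L - (E.card + 3)) := by
  have hsa : s ≠ a := fun h => haE (h ▸ hsE)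
  have hsb : s ≠ b := fun h => hbE (h ▸ hsE)
  have hsc : s ≠ c := fun h => hcE (h ▸ hsE)
  have hw := sectorWidth_pos n'
  have hAf : 0 < Af := hcf.trans_le hcfA
  set Cl := (Finset.univ : Finset (Fin L → Fin (sectorCount n'))).filter fun ω =>
        ((∀ e ∈ E, ω e = τ e) ∧ (∀ i : Fin L, i ∉ E → pairAngle (sectorCenter n' (ω i)) (sectorCenter n' (τ s) + σ) ≤ 2 * Φ₀)) ∧
        (∀ x ∈ ({a, b, c} : Finset (Fin L)), FermiRG.torusDist (sectorCenter n' (ω x) - (sectorCenter n' (ω s) + σ)) ≤ 2 * Φ₀) ∧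
        ∃ k : Fin L → (Fin 2 → ℝ), (∀ i, k i ∈ sSector u e₀ n' (ω i : ℕ)) ∧ ∑ i, k i = R with hCl
  set Tb : ℝ := (2 * (L * (4 * c₃ * (2 : ℝ) ^ (-(n' : ℤ)))) / (s₁ / 2 * sectorWidth n') + 1) *
        (960 * Af * (2 * (L * (4 * c₃ * (2 : ℝ) ^ (-(n' : ℤ))) + Bf * (L * (4 * c₃ * (2 : ℝ) ^ (-(n' : ℤ))))) +
          (4 * Bf + 1) * (s₁ / 2 * sectorWidth n')) / cf ^ 2 / (s₁ / 2 * sectorWidth n') ^ 2) with hTb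
  have hTb0 : 0 ≤ Tb := by rw [hTb]; positivity
  refine card_le_mul_pow_of_fibres E τ a b c haE hbE hcE hab hac hbc (sectorCenter n' (τ s) + σ) hΦ₀ hTb0 Cl
    (fun ω hω => by rw [hCl, Finset.mem_filter] at hω; exact hω.2.1) fun ρ => ?_
  have h := card_classFibre_le_pred hD hc₃ h73 hs₁ hM₁ hΦ hcf hcfA hBf hchart
    (fun ω => (∀ e ∈ E, ω e = τ e) ∧ (∀ i : Fin L, i ∉ E → pairAngle (sectorCenter n' (ω i)) (sectorCenter n' (τ s) + σ) ≤ 2 * Φ₀))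
    s a b c hsa hsb hsc hab hac hbc R hΦ₀ h2Φ₀ σ hreg ρ
  rw [hTb]
  convert h using 2
  congr 1
  ext ω
  simp only [hCl, Finset.mem_filter, Finset.mem_univ, true_and]

open Classical in
set_option maxHeartbeats 400000 in -- large explicit statements
/-- **The count of one narrow class, MIXED pattern** (kept legs `a, b ∉ E` within `2Φ₀` of `θ⋆ = θ_{n′,ω_s} + σ`, `c ∉ E` within `2Φ₀` of `θ⋆ + π`, `s ∈ E`;
free legs within pair angle `2Φ₀` of `θ_{n′,τ_s} + σ`): `#class ≤ T_indef · K₁^{L − (|E|+3)}`. [cite: BenfattoGiulianiMastropietro2003, §7.4 (s1.23)–(s1.25a) p.28 (L33–52)] -/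
theorem card_class34_opp_le {ε : (Fin 2 → ℝ) → ℝ} {μ e₀ : ℝ} {u : ℝ → ℝ → ℝ} (hD : DispersionHyp ε μ e₀ u) {c₃ : ℝ} (hc₃ : 0 < c₃)
    (h73 : ∀ (n ω : ℕ), ω < sectorCount n → ∀ p ∈ sSector u e₀ n ω,
      ∃ k₁ k₂ : ℝ,
        p = fermiPoint u (sectorCenter n ω) + k₁ • unitNormal u (sectorCenter n ω) 0 +
              k₂ • unitTangent u (sectorCenter n ω) 0 ∧
        |k₁| ≤ c₃ * (4 : ℝ) ^ (-(n : ℤ)) ∧ |k₂| ≤ c₃ * (2 : ℝ) ^ (-(n : ℤ)) ∧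
        |fderiv ℝ ε p (unitTangent u (sectorCenter n ω) 0)| ≤ c₃ * (2 : ℝ) ^ (-(n : ℤ)))
    {s₁ Φ cf Af Bf M₁ : ℝ} (hs₁ : 0 < s₁) (hM₁ : 0 ≤ M₁) (hΦ : 0 < Φ) (hcf : 0 < cf) (hBf : 0 ≤ Bf)
    (hchart : ∀ θs : ℝ, ∃ f f' f'' : ℝ → ℝ, Measurable f ∧
        (∀ φ ∈ Icc (-Φ) Φ,
          f ((fermiPoint u (θs + φ) - fermiPoint u θs) ⬝ᵥ tdir θs) = -((fermiPoint u (θs + φ) - fermiPoint u θs) ⬝ᵥ dir θs)) ∧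
        (∀ y ∈ Icc (-(s₁ / 4 * Φ)) (s₁ / 4 * Φ), HasDerivAt f (f' y) y ∧ HasDerivAt f' (f'' y) y ∧
          cf ≤ f'' y ∧ f'' y ≤ Af ∧ |f' y| ≤ Bf) ∧
        (∀ φ ∈ Icc (-Φ) Φ, ∀ φ' ∈ Icc (-Φ) Φ,
          s₁ / 2 * |φ - φ'| ≤ |(fermiPoint u (θs + φ) - fermiPoint u θs) ⬝ᵥ tdir θs - (fermiPoint u (θs + φ') - fermiPoint u θs) ⬝ᵥ tdir θs| ∧
          |(fermiPoint u (θs + φ) - fermiPoint u θs) ⬝ᵥ tdir θs - (fermiPoint u (θs + φ') - fermiPoint u θs) ⬝ᵥ tdir θs| ≤ M₁ * |φ - φ'|) ∧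
        (fermiPoint u (θs + 0) - fermiPoint u θs) ⬝ᵥ tdir θs = 0)
    {n' L : ℕ} (E : Finset (Fin L)) (τ : Fin L → Fin (sectorCount n')) (s a b c : Fin L)
    (hsE : s ∈ E) (haE : a ∉ E) (hbE : b ∉ E) (hcE : c ∉ E) (hab : a ≠ b) (hac : a ≠ c) (hbc : b ≠ c)
    (R : Fin 2 → ℝ) {Φ₀ : ℝ} (hΦ₀ : 0 ≤ Φ₀) (h2Φ₀ : 2 * Φ₀ ≤ Φ) (σ : ℝ)
    (hreg : 6 * (M₁ * (2 * Φ₀)) + 3 * (L * (4 * c₃ * (2 : ℝ) ^ (-(n' : ℤ)))) + 2 * (s₁ / 2 * sectorWidth n') ≤ s₁ / 4 * Φ) :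
    ((((Finset.univ : Finset (Fin L → Fin (sectorCount n'))).filter fun ω =>
        ((∀ e ∈ E, ω e = τ e) ∧ (∀ i : Fin L, i ∉ E → pairAngle (sectorCenter n' (ω i)) (sectorCenter n' (τ s) + σ) ≤ 2 * Φ₀)) ∧
        (FermiRG.torusDist (sectorCenter n' (ω a) - (sectorCenter n' (ω s) + σ)) ≤ 2 * Φ₀ ∧
          FermiRG.torusDist (sectorCenter n' (ω b) - (sectorCenter n' (ω s) + σ)) ≤ 2 * Φ₀ ∧
          FermiRG.torusDist (sectorCenter n' (ω c) - (sectorCenter n' (ω s) + σ + π)) ≤ 2 * Φ₀) ∧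
        ∃ k : Fin L → (Fin 2 → ℝ), (∀ i, k i ∈ sSector u e₀ n' (ω i : ℕ)) ∧ ∑ i, k i = R).card : ℝ)) ≤
      (2 * (L * (4 * c₃ * (2 : ℝ) ^ (-(n' : ℤ)))) / (s₁ / 2 * sectorWidth n') + 1) *
        (4 * (2 * (M₁ * (2 * Φ₀)) / (s₁ / 2 * sectorWidth n') + 1) +
          4 * (L * (4 * c₃ * (2 : ℝ) ^ (-(n' : ℤ))) + Bf * (L * (4 * c₃ * (2 : ℝ) ^ (-(n' : ℤ))))) / (cf * (s₁ / 2 * sectorWidth n') ^ 2) *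
            (1 + Real.log ((4 * (M₁ * (2 * Φ₀)) + L * (4 * c₃ * (2 : ℝ) ^ (-(n' : ℤ)))) / (s₁ / 2 * sectorWidth n') + 1))) *
      (2 * (2 * (2 * Φ₀) / sectorWidth n' + 1)) ^ (L - (E.card + 3)) := by
  have hsa : s ≠ a := fun h => haE (h ▸ hsE)
  have hsb : s ≠ b := fun h => hbE (h ▸ hsE)
  have hsc : s ≠ c := fun h => hcE (h ▸ hsE)
  have hw := sectorWidth_pos n'
  set Cl := (Finset.univ : Finset (Fin L → Fin (sectorCount n'))).filter fun ω =>
        ((∀ e ∈ E, ω e = τ e) ∧ (∀ i : Fin L, i ∉ E → pairAngle (sectorCenter n' (ω i)) (sectorCenter n' (τ s) + σ) ≤ 2 * Φ₀)) ∧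
        (FermiRG.torusDist (sectorCenter n' (ω a) - (sectorCenter n' (ω s) + σ)) ≤ 2 * Φ₀ ∧
          FermiRG.torusDist (sectorCenter n' (ω b) - (sectorCenter n' (ω s) + σ)) ≤ 2 * Φ₀ ∧
          FermiRG.torusDist (sectorCenter n' (ω c) - (sectorCenter n' (ω s) + σ + π)) ≤ 2 * Φ₀) ∧
        ∃ k : Fin L → (Fin 2 → ℝ), (∀ i, k i ∈ sSector u e₀ n' (ω i : ℕ)) ∧ ∑ i, k i = R with hCl
  set Tb : ℝ := (2 * (L * (4 * c₃ * (2 : ℝ) ^ (-(n' : ℤ)))) / (s₁ / 2 * sectorWidth n') + 1) *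
        (4 * (2 * (M₁ * (2 * Φ₀)) / (s₁ / 2 * sectorWidth n') + 1) +
          4 * (L * (4 * c₃ * (2 : ℝ) ^ (-(n' : ℤ))) + Bf * (L * (4 * c₃ * (2 : ℝ) ^ (-(n' : ℤ))))) / (cf * (s₁ / 2 * sectorWidth n') ^ 2) *
            (1 + Real.log ((4 * (M₁ * (2 * Φ₀)) + L * (4 * c₃ * (2 : ℝ) ^ (-(n' : ℤ)))) / (s₁ / 2 * sectorWidth n') + 1))) with hTb
  have hlog : 0 ≤ Real.log ((4 * (M₁ * (2 * Φ₀)) + L * (4 * c₃ * (2 : ℝ) ^ (-(n' : ℤ)))) / (s₁ / 2 * sectorWidth n') + 1) :=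
    Real.log_nonneg (by
      have : 0 ≤ (4 * (M₁ * (2 * Φ₀)) + L * (4 * c₃ * (2 : ℝ) ^ (-(n' : ℤ)))) / (s₁ / 2 * sectorWidth n') := by positivity
      linarith)
  have hTb0 : 0 ≤ Tb := by rw [hTb]; positivity
  refine card_le_mul_pow_of_fibres E τ a b c haE hbE hcE hab hac hbc (sectorCenter n' (τ s) + σ) hΦ₀ hTb0 Cl
    (fun ω hω => by rw [hCl, Finset.mem_filter] at hω; exact hω.2.1) fun ρ => ?_
  have h := card_classFibre_le_mixed hD hc₃ h73 hs₁ hM₁ hΦ hcf hBf hchart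
    (fun ω => (∀ e ∈ E, ω e = τ e) ∧ (∀ i : Fin L, i ∉ E → pairAngle (sectorCenter n' (ω i)) (sectorCenter n' (τ s) + σ) ≤ 2 * Φ₀))
    s a b c hsa hsb hsc hab hac hbc R hΦ₀ h2Φ₀ σ hreg ρ
  rw [hTb]
  convert h using 2
  congr 1
  ext ω
  simp only [hCl, Finset.mem_filter, Finset.mem_univ, true_and]

end Summit.HubbardSuperconductivity.HubbardSuperconductivity.Theorems.AbsUmklappCount

end
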